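import Summits.QuantumFields.QCD.Theses.EulerDescent
import Summits.QuantumFields.QCD.Theses.GapBuysCauchyRate
import Summits.QuantumFields.QCD.Theorems.GapBuysCauchyRateConvergentOSClosureStubClosureOfLatticeInputs
import Summits.QuantumFields.QCD.Theorems.GapBuysCauchyRateRotationRestorationLatticeInvariancePassesToLimit
import Summits.QuantumFields.QCD.Theorems.GapBuysCauchyRateRotationRestorationSeparatedTensorsTotal
import Literature.Analysis.Complex.VitaliIdentityTransport
import HarnessLib.Audit

/-!
# Line `vitali-mass-descent` for crux `RetypedContinuumComplement` (item stmt-QuantumFields-16903) —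
# skeleton v3 (lead reshapes r1–r2 by lead 0, r3 by continuation lead c1, 2026-08-17)

Route `route-QuantumFields-EulerDescent` (sub-problem QCD), crux decl
`Summit.QuantumFields.QCD.Theses.EulerDescent.RetypedContinuumComplement` (rank 5, XL): for
`N_f ∈ {2,3}` and EVERY mass-independent regularisation `reg` (`HasMassScaling`, two-loop asymptotic
scaling, `mcrit(k) > −1` eventually) which carries the `QCDOf` body at every tuple above some heavy
threshold `M_h` AND a uniform lattice gap at every positive tuple, `reg` carries the body at EVERY
positive tuple — for the SAME `reg` (no threshold shift, no subsequence).

LINE = **VITALI DESCENT IN THE COMPLEX QUARK MASS** (strategist seat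
`planner-cstrat-stmt-QuantumFields-16903-b1-0`; lens: transfer — Glimm–Jaffe Thm 4.6.2 / Cor. 18.1.4:
"finite-volume analyticity + zero-free uniform bounds + convergence on a real sub-interval ⇒ Vitali ⇒
convergence everywhere").  Along every mass ray `l ↦ l·m` (`l ≥ 1`) the calibrated lattice `n`-point
functions at step `k` are restrictions of functions HOLOMORPHIC in `l`; IF the gap buys a `k`-UNIFORM
complex collar around `[1, L]` on which they are `k`-uniformly bounded (`AnalyticRayCollar`, V2, the
load-bearing stub), then — since the heavy part of the ray converges (heavy body, recalibrated) —
VITALI'S THEOREM (in tree: `Literature.Analysis.Complex.exists_tendstoLocallyUniformlyOn_of_frequently_tendsto`)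
forces convergence along the FULL sequence at `l = 1`, i.e. at the light tuple.

## Reshape r1 (this file; wave-1 verdicts of 2026-08-17 integrated)

* `stub_convergentOSClosure : GapBuysCauchyRate.ConvergentOSClosure` (S2, item stmt-11525 BY NAME) —
  worker verdict `stub-misstated` (six lead seats of stmt-11525 concur): the typed decl is closed only
  modulo four lattice-side inputs its hypotheses do not carry.  REPLACED by the LANDED repaired crux R′,
  `Summit.QuantumFields.QCD.Theorems.ConvergentOSClosure.convergentOSClosure_retyped` (p161129), which is
  now CALLED, not stubbed; its extra inputs at the light tuple — (T ∧ COMP) `k`-uniform E0′ bound +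
  thermal comparison, (CL) `k`-uniform spatial clustering, (CS) species CS clustering — become the two
  new light-side stubs `stub_lightUVInputs` (with the glue `κ₃`-witness) and `stub_lightClustering`.
* `stub_rotationRestoration : GapBuysCauchyRate.RotationRestoration` (S3, item stmt-8840 BY NAME) —
  worker verdict `stub-blocked` (equivalent to 8840's open planar Ward stub).  ELIMINATED from this crux
  by the device of card `heavy-axioms-ride-the-collar`: E1 of the heavy body's OS data is INHERITED along
  the collar — the rotation defect of the calibrated functions is holomorphic in `l`, vanishes on the
  heavy segment, hence at `l = 1` (identity theorem).  PROVED here, sorry-free: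
  `hasPairedCollar_of_collars` (common connected collar for a tuple and its rotate: connected component
  of the intersection), `exists_limit_of_collar` (Vitali packaged), `rotationsInheritedAt_of_collars`
  (identity theorem on the two Vitali limits), `rotation_hypothesis_of_inherited` (passage from real
  separated tensors to all of `⁰𝒮`: totality `stub_separatedTensorsTotal`, landed p151153).  The heavy
  half — "the recalibrated heavy limits are rotation invariant" — is a clause of `stub_calibratedHeavyBody`.
* `stub_liveRecalibration : LiveRecalibration` (V1) — worker verdict `stub-blocked`
  (`Literature…KallenLehmannPositivity`, no `_holds`; light halves are no item of the tree; and (c) is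
  underivable from the crux's SIGN-FREE heavy body: `z_b := (−1)^k z_cal` with the same `T` satisfies HB
  verbatim).  RESHAPED into `stub_calibratedHeavyBody` (V1h: ∃ 𝒞 with compact biting, and above some
  `M_h'` full-sequence convergence AND rotation inheritance of the calibrated functions) — its `κ₃` clause
  moves to the light stub.  The sign seam is recorded on the stub (planner: re-type HB with `0 < z`).
* `stub_analyticRayCollar : AnalyticRayCollar` (V2) — UNCHANGED (registered; the lead's stub; crux-sized:
  `k`-uniform zero-free collar + `k`-uniform bounds with light Wilson quarks ⊇ fermionic UV stability).

Stubs of v2 (the ONLY `sorry`s): `stub_calibratedHeavyBody`, `stub_analyticRayCollar`,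
`stub_lightUVInputs`, `stub_lightClustering`.  `RetypedContinuumComplement_of` (§6) concludes the crux
BY NAME from the four stub statements and is kernel-checked.

Reshape r2 (wave-2 verdicts, same day): the two light stubs now take the data §6 already holds when it calls
them — full-sequence convergence at `m` (Vitali) and, for L_IR, (T ∧ COMP) — as hypotheses, which makes them
VERBATIM instances (`sch := 𝒞.scheme m`) of the four registered OPEN stubs of item stmt-QuantumFields-11525
(`stub_tightness`, `stub_thermalComparison`, `stub_spatialClustering`, `stub_speciesCSClustering`), plus the
`κ₃` clause: §1b states those pool statements verbatim and §3b proves the reductions `tightComp_of_pool`,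
`lightUVInputs_of_pool`, `lightClustering_of_pool`.  Wave-2 verdicts: V1h `stub-blocked`
(KallenLehmannPositivity; the new rotation clause adds no seam), L_UV `stub-blocked` (11525 `stub_tightness`),
L_IR `stub-blocked` (11525 `stub_speciesCSClustering` / `stub_spatialClustering`).

## Reshape r3 (continuation lead c1, 2026-08-17): V1h split along the light/heavy seam

`stub_calibratedHeavyBody` (V1h) bundled two unrelated open inputs: compact biting at LIGHT tuples
(`k`-uniform positivity of the bare reference two-point functions with light Wilson quarks — a lattice
reflection-positivity + non-degeneracy statement; the tree holds only the PREDICATE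
`WilsonQCDSiteReflectionPositivityAP`, no proof, and for the antiperiodic functional) and the HEAVY
recalibration (convergence + rotation inheritance of ONE calibrated family above some `M_h'`, from the heavy
body; seams: `KallenLehmannPositivity` for the flagged species, non-triviality of the unflagged non-null
species `pseudoRe f f` / `pseudoIm f g`, and the sign-freedom of the body's `z`).  They are now two stubs:
`stub_lightBiting : LightBiting` (biting holds for EVERY calibrated family over `reg` — it reads only the bare
connected reference functions) and `stub_heavyCalibration : HeavyCalibration` (∃ 𝒞 with heavy convergence
and heavy rotation inheritance).  The pinned calibrated family EXISTS unconditionally for every `reg`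
(landed `LadderCauchyRate.Birth.stub_calibratedFamily` + `stub_onePointTranslation` / `stub_onePointFlavour` /
`stub_onePointPseudoDiag` / `stub_speciesMultilinear`, all sorry-free in Theorems/): the `∃ 𝒞` of
`HeavyCalibration` is not the content, the convergence of ITS functions is.  Composition unchanged otherwise;
stubs of v3 (the ONLY `sorry`s): `stub_lightBiting`, `stub_heavyCalibration`, `stub_analyticRayCollar`,
`stub_lightUVInputs`, `stub_lightClustering` (5 ≤ stubs_max 7).

## Negative knowledge honoured / Disproof used
* `Disproof.lean` cycle 1 (refuter-cdisprove, 2026-08-17T14:42Z) READ: no stuck-stub targets; (H2) redundant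
  given (H4); (H5) and the FULL-SEQUENCE clause of (H4) are load-bearing — this line consumes both (the lattice
  gap feeds R′ and V2; the heavy segment is the uniqueness set of the identity theorem / Vitali, a
  subsequential heavy body would only give the absurd mass-blind variant `massBlind_of_subseqCrux`);
  `collarAtOne_iff_eventuallyBounded`: at `L = 1` V2 is eventual `k`-boundedness of the calibrated function,
  so V2 ⊇ UV stability in ratio form (recorded on V2; no reshape can remove it).
* (superseded note of v2) No `Disproof.lean` existed at the time of reshape r1 (2026-08-17T14:40Z).
* Free-data refutations of V2 are impossible by the design of `CalibratedSpeciesFamily` (one-point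
  subtraction pins `shift`, calibration pins `z` where the calibrating function is a positive real, null
  species `pseudoIm f f` are identically zero); every stub carries the heavy body HB among its hypotheses,
  so no stub is refutable in the tree without an honest heavy-quark QCD — recorded, not exploited.
-/

noncomputable section

namespace Summit.QuantumFields.QCD.Cruxes.RetypedContinuumComplement.VitaliMassDescent

open Filter Topology
open Literature.MathematicalPhysics.AQFT Literature.MathematicalPhysics.QuantumLattice
  Literature.MathematicalPhysics.QuantumFieldTheory
open Summit.QuantumFields.QCD.Theses.EulerDescent (RetypedContinuumComplement)
open Summit.QuantumFields.QCD.Cruxes.StableActionBridge.Sketch (qcdLatticeDist qcdLatticeDistSymAP)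
open Summit.QuantumFields.QCD.Cruxes.RotationRestoration.Birth (IsSeparated stub_separatedTensorsTotal)
open Summit.QuantumFields.QCD.Cruxes.RotationRestoration.Birth.LatticeInvariancePassesToLimit
  (isOffDiagonal_linActMulti isTensorOf_linActMulti_ofRealTest linActMulti_fin_zero
    isOffDiagonal_of_isSeparated)

variable {Nf : ℕ}

/-- `ℝ⁴` (file-local notation). -/
local notation "E4" => EuclideanSpace ℝ (Fin 4)

/-! ## §0 Currency (clauses VERBATIM those of the crux and of R′ = `convergentOSClosure_retyped`) -/

/-- **The `QCDOf` body of `reg` at the renormalised mass tuple `m`** (verbatim matrix of the re-typed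
`QCDOf`, of the hypothesis and of the conclusion of the crux). -/
def Body (reg : QCDRegularisation Nf) (m : Fin Nf → ℝ) : Prop :=
  ∃ (z shift : QCDField Nf → ℕ → ℝ) (T : OSData (QCDField Nf) 4),
    IsQCDAlong (reg.scheme m z shift) T ∧ T.IsNontrivial QCDField.glue ∧ T.IsNonGaussian QCDField.glue ∧
      (∀ f g : Fin Nf, f ≠ g → T.IsNontrivial (QCDField.pseudoRe f g)) ∧
        ∃ Δ > 0, T.HasMassGap Δ ∧ (reg.scheme m z shift).HasLatticeMassGap Δ

/-- **The lattice `κ₃`-witness for `glue` at `m`** (clause of R′, verbatim). -/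
def GlueKappa3Witness {reg : QCDRegularisation Nf} (𝒞 : CalibratedSpeciesFamily reg) (m : Fin Nf → ℝ) :
    Prop :=
  ∃ f g h : SchwartzMap (EuclideanSpace ℝ (Fin 4)) ℝ,
    tsupport (f : EuclideanSpace ℝ (Fin 4) → ℝ) ⊆ {x | x 0 < 0} ∧
    tsupport (g : EuclideanSpace ℝ (Fin 4) → ℝ) ⊆ {x | 0 < x 0 ∧ x 0 < 1} ∧
    tsupport (h : EuclideanSpace ℝ (Fin 4) → ℝ) ⊆ {x | 1 < x 0} ∧
    ∃ ε > (0 : ℝ), ∀ᶠ k in Filter.atTop, ε ≤ ‖qcdLatticeSchwinger (𝒞.scheme m) k 3 ![QCDField.glue, QCDField.glue, QCDField.glue] ![f, g, h] - qcdLatticeSchwinger (𝒞.scheme m) k 1 ![QCDField.glue] ![f] * qcdLatticeSchwinger (𝒞.scheme m) k 2 ![QCDField.glue, QCDField.glue] ![g, h] - qcdLatticeSchwinger (𝒞.scheme m) k 1 ![QCDField.glue] ![g] * qcdLatticeSchwinger (𝒞.scheme m) k 2 ![QCDField.glue, QCDField.glue] ![f, h] - qcdLatticeSchwinger (𝒞.scheme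 m) k 1 ![QCDField.glue] ![h] * qcdLatticeSchwinger (𝒞.scheme m) k 2 ![QCDField.glue, QCDField.glue] ![f, g] + 2 * (qcdLatticeSchwinger (𝒞.scheme m) k 1 ![QCDField.glue] ![f] * qcdLatticeSchwinger (𝒞.scheme m) k 1 ![QCDField.glue] ![g] * qcdLatticeSchwinger (𝒞.scheme m) k 1 ![QCDField.glue] ![h])‖

/-- **Full-sequence convergence of the calibrated family at `m`** (clause of R′, verbatim): every
calibrated lattice `n`-point function (`n ≥ 1`, every species string, every tuple of real test functions
carrying an off-diagonal tensor) converges as `k → ∞` along the WHOLE sequence. -/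
def ConvergesOnTensors {reg : QCDRegularisation Nf} (𝒞 : CalibratedSpeciesFamily reg) (m : Fin Nf → ℝ) :
    Prop :=
  ∀ n : ℕ, n ≠ 0 → ∀ (σ : Fin n → QCDField Nf) (f : Fin n → SchwartzMap (EuclideanSpace ℝ (Fin 4)) ℝ)
    (F : SchwartzMap (Fin n → EuclideanSpace ℝ (Fin 4)) ℂ),
    IsTensorOf F (fun i => ofRealTest (f i)) → IsOffDiagonal F →
      ∃ c : ℂ, Filter.Tendsto (fun k : ℕ => qcdLatticeSchwinger (𝒞.scheme m) k n σ f) Filter.atTop (nhds c)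

/-- **Rotation inheritance at `m`, at the level of lattice limits**: for every off-diagonal real tensor
tuple `f` and every proper rotation `R` of `ℝ⁴`, the `k → ∞` limits (when they exist) of the calibrated
functions of `f` and of the rotated tuple `fᵢ ∘ R⁻¹` (`linActTest R`) AGREE.  Once a labelled family `S`
IS the limit, this is exactly the rotation INPUT of R′'s packaging clause (`rotation_hypothesis_of_inherited`). -/
def RotationsInheritedAt {reg : QCDRegularisation Nf} (𝒞 : CalibratedSpeciesFamily reg) (m : Fin Nf → ℝ) :
    Prop :=
  ∀ n : ℕ, n ≠ 0 → ∀ (σ : Fin n → QCDField Nf) (f : Fin n → SchwartzMap (EuclideanSpace ℝ (Fin 4)) ℝ)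
    (F : SchwartzMap (Fin n → EuclideanSpace ℝ (Fin 4)) ℂ),
    IsTensorOf F (fun i => ofRealTest (f i)) → IsOffDiagonal F →
      ∀ R : E4 ≃ₗᵢ[ℝ] E4, LinearMap.det (R.toLinearEquiv : E4 →ₗ[ℝ] E4) = 1 →
        ∀ c c' : ℂ, Filter.Tendsto (fun k : ℕ => qcdLatticeSchwinger (𝒞.scheme m) k n σ f) Filter.atTop (nhds c) →
          Filter.Tendsto (fun k : ℕ => qcdLatticeSchwinger (𝒞.scheme m) k n σ
            (fun i => linActTest (𝕜 := ℝ) R (f i))) Filter.atTop (nhds c') → c' = c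

/-- **The calibration bites eventually, uniformly on compacts of positive tuples, for every non-null
species** (the shape of conclusion (i) of `DiagonalSpine.CalibratedTightness`): on every compact set `K`
of positive mass tuples, for all large `k`, the calibrated two-point function on the reference pair
`(Θf₀, f₀)` of every species other than the null fields `pseudoIm f f` EQUALS `1` at every `m ∈ K`. -/
def BitesOnCompacts {reg : QCDRegularisation Nf} (𝒞 : CalibratedSpeciesFamily reg) : Prop :=
  ∀ K : Set (Fin Nf → ℝ), IsCompact K → K ⊆ {m | ∀ fl, 0 < m fl} →
    ∀ᶠ k in Filter.atTop, ∀ m ∈ K, ∀ s : QCDField Nf, (∀ fl, s ≠ QCDField.pseudoIm fl fl) →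
      (𝒞.scheme m).twoPoint k s s (thetaTest 4 𝒞.f₀) 𝒞.f₀ = 1

/-- **Analytic collar of the calibrated `n`-point functions along the ray segment `[1, L]·m`**: a
connected open `U ⊆ ℂ` containing the real segment `[1, L]`, ONE bound `C` and functions
`G_k : ℂ → ℂ`, each holomorphic on `U` and bounded by `C` there, which on the real segment and
eventually in `k` ARE the calibrated lattice `n`-point functions of the tuple `(σ, f)` at the mass
tuple `l • m`. -/
def HasAnalyticCollar {reg : QCDRegularisation Nf} (𝒞 : CalibratedSpeciesFamily reg) (m : Fin Nf → ℝ)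
    (L : ℝ) (n : ℕ) (σ : Fin n → QCDField Nf) (f : Fin n → SchwartzMap (EuclideanSpace ℝ (Fin 4)) ℝ) :
    Prop :=
  ∃ U : Set ℂ, IsOpen U ∧ IsPreconnected U ∧ (∀ l : ℝ, l ∈ Set.Icc 1 L → ((l : ℂ) ∈ U)) ∧
    ∃ (C : ℝ) (G : ℕ → ℂ → ℂ), (∀ k, DifferentiableOn ℂ (G k) U) ∧ (∀ k, ∀ w ∈ U, ‖G k w‖ ≤ C) ∧
      ∀ᶠ k in Filter.atTop, ∀ l : ℝ, l ∈ Set.Icc 1 L →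
        G k (l : ℂ) = qcdLatticeSchwinger (𝒞.scheme (l • m)) k n σ f

/-- **Paired analytic collar** of two test tuples `f, f'` on ONE connected open set (derived from two
single collars in `hasPairedCollar_of_collars`; it is what the identity theorem on the difference needs). -/
def HasPairedCollar {reg : QCDRegularisation Nf} (𝒞 : CalibratedSpeciesFamily reg) (m : Fin Nf → ℝ)
    (L : ℝ) (n : ℕ) (σ : Fin n → QCDField Nf)
    (f f' : Fin n → SchwartzMap (EuclideanSpace ℝ (Fin 4)) ℝ) : Prop :=
  ∃ U : Set ℂ, IsOpen U ∧ IsPreconnected U ∧ (∀ l : ℝ, l ∈ Set.Icc 1 L → ((l : ℂ) ∈ U)) ∧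
    ∃ (C : ℝ) (G G' : ℕ → ℂ → ℂ), (∀ k, DifferentiableOn ℂ (G k) U) ∧ (∀ k, DifferentiableOn ℂ (G' k) U) ∧
      (∀ k, ∀ w ∈ U, ‖G k w‖ ≤ C) ∧ (∀ k, ∀ w ∈ U, ‖G' k w‖ ≤ C) ∧
      ∀ᶠ k in Filter.atTop, ∀ l : ℝ, l ∈ Set.Icc 1 L →
        G k (l : ℂ) = qcdLatticeSchwinger (𝒞.scheme (l • m)) k n σ f ∧
        G' k (l : ℂ) = qcdLatticeSchwinger (𝒞.scheme (l • m)) k n σ f'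

/-- **(T ∧ COMP) at `m`** — R′'s first extra input, verbatim for the scheme `𝒞.scheme m`: ONE norm
index `s` with the `k`-uniform E0′ bound of the canonical lattice distributions `qcdLatticeDist` on `⁰𝒮`
AND the `ε`-uniform E0′-norm comparison with the `Θ`-symmetrised thermal distributions
`qcdLatticeDistSymAP`. -/
def TightComp {reg : QCDRegularisation Nf} (𝒞 : CalibratedSpeciesFamily reg) (m : Fin Nf → ℝ) : Prop :=
  ∃ (s : ℕ) (α β : ℝ), 0 ≤ α ∧
    (∀ (n : ℕ) (σ : Fin n → QCDField Nf), ∀ᶠ k in Filter.atTop, ∀ F : SchwartzMap (Fin n → EuclideanSpace ℝ (Fin 4)) ℂ, IsOffDiagonal F → ‖qcdLatticeDist (𝒞.scheme m) k n σ F‖ ≤ α * (n.factorial : ℝ) ^ β * schwartzNorm (n * s) F) ∧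
    (∀ ε : ℝ, 0 < ε →
      ∀ (n : ℕ) (σ : Fin n → QCDField Nf), ∀ᶠ k in Filter.atTop, ∀ F : SchwartzMap (Fin n → EuclideanSpace ℝ (Fin 4)) ℂ, IsOffDiagonal F → ‖qcdLatticeDistSymAP (𝒞.scheme m) k n σ F - qcdLatticeDist (𝒞.scheme m) k n σ F‖ ≤ ε * schwartzNorm (n * s) F)

/-- **(CL) at `m`** — R′'s `k`-uniform spatial clustering input, verbatim for `𝒞.scheme m`. -/
def SpatialClustering {reg : QCDRegularisation Nf} (𝒞 : CalibratedSpeciesFamily reg) (m : Fin Nf → ℝ) :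
    Prop :=
  ∀ (n n' : ℕ) (σ : Fin n → QCDField Nf) (σ' : Fin n' → QCDField Nf) (F : SchwartzMap (Fin n → EuclideanSpace ℝ (Fin 4)) ℂ) (G : SchwartzMap (Fin n' → EuclideanSpace ℝ (Fin 4)) ℂ), IsTimeOrdered F → IsTimeOrdered G →
    ∀ a : EuclideanSpace ℝ (Fin 4), a 0 = 0 → a ≠ 0 →
    ∀ ε : ℝ, 0 < ε →
    ∃ t₀ : ℝ, ∀ t : ℝ, t₀ ≤ t →
    ∀ H : SchwartzMap (Fin (n + n') → EuclideanSpace ℝ (Fin 4)) ℂ, IsAppendTensorOf H (osAdjoint F) (translateMulti (t • a) G) →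
    ∀ᶠ k in Filter.atTop, ‖qcdLatticeDist (𝒞.scheme m) k (n + n') (Fin.append (σ ∘ Fin.rev) σ') H - qcdLatticeDist (𝒞.scheme m) k n (σ ∘ Fin.rev) (osAdjoint F) * qcdLatticeDist (𝒞.scheme m) k n' σ' G‖ ≤ ε

/-- **(CS) at `m`** — R′'s species Cauchy–Schwarz clustering input at some positive rate. -/
def SpeciesClustering {reg : QCDRegularisation Nf} (𝒞 : CalibratedSpeciesFamily reg) (m : Fin Nf → ℝ) :
    Prop :=
  ∃ Δ' > 0, (𝒞.scheme m).HasSpeciesCSClustering Δ'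

/-! ## §1 The stub statements -/

/-- **(V1ℓ) THE CALIBRATION BITES ON COMPACTS OF POSITIVE TUPLES, FOR EVERY CALIBRATED FAMILY** (L–XL;
reshape r3, the light half of the former V1h).  Hypotheses = the crux's, verbatim.  Conclusion: for EVERY
calibrated species family `𝒞` over `reg`, the calibration bites eventually, uniformly on compacts of
positive tuples, for all non-null species (`BitesOnCompacts`).  By the landed calibration transfer
(`LadderCauchyRate.Birth.stub_calibrationTransfer`) biting at `(m, s, k)` is implied by — and, unfolding the
calibration identity, equivalent to — "the BARE (`z ≡ 1`) connected reference two-point function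
`⟨Φ^s(Θf₀) Φ^s(f₀)⟩_conn` at `(m, k)` is a positive real", a property of the honest torus functional alone
(the family enters only through `f₀`).  Content: (a) reality (proved for `glue`:
`LadderCauchyRate.Birth.stub_glueTwoPointReal`; mesons: `γ₅`-hermiticity / flavour phases, provable);
(b) non-negativity = reflection positivity of the PERIODIC torus functional with Wilson quarks on the branch
`m_f(k) > −1` (tree: only the predicate `WilsonQCDSiteReflectionPositivityAP`, for the ANTIPERIODIC functional,
unproved; periodic ↔ antiperiodic is the thermal comparison COMP of stmt-11525); (c) STRICT positivity,
eventually in `k`, uniformly on compacts of LIGHT tuples — non-degeneracy of every non-null channel with light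
Wilson quarks, `k`-uniformly: reached by no crux hypothesis (the lattice gap (H5) is an upper bound). -/
def LightBiting : Prop :=
  ∀ Nf : ℕ, Nf = 2 ∨ Nf = 3 → ∀ reg : QCDRegularisation Nf, reg.HasMassScaling →
    (reg.scheme 0 0 0).HasAsymptoticScaling → (∀ᶠ k in Filter.atTop, (-1 : ℝ) < reg.mcrit k) →
      (∃ Mh : ℝ, 0 < Mh ∧ ∀ m : Fin Nf → ℝ, (∀ f, Mh ≤ m f) → Body reg m) →
        (∀ m : Fin Nf → ℝ, (∀ f, 0 < m f) → ∃ Δ > 0, (reg.scheme m 0 0).HasLatticeMassGap Δ) →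
          ∀ 𝒞 : CalibratedSpeciesFamily reg, BitesOnCompacts 𝒞

/-- **(V1h′) THE HEAVY BODY, RECALIBRATED: ONE CALIBRATED FAMILY WITH HEAVY CONVERGENCE AND HEAVY ROTATION
INHERITANCE** (L; reshape r3, the heavy half of the former V1h).  Hypotheses = the crux's, verbatim.
Conclusion: ONE calibrated species family `𝒞` over THIS `reg` and an `M_h' > 0` above which ALL calibrated
`n`-point functions converge along the full sequence AND the limits of every tuple and of its proper rotates
agree (`RotationsInheritedAt`).  The calibrated family itself EXISTS for every `reg` (the pinned family:
landed `LadderCauchyRate.Birth.stub_calibratedFamily` with the landed one-point law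
`stub_onePointTranslation` / `stub_onePointFlavour` / `stub_onePointPseudoDiag` and species multilinearity
`stub_speciesMultilinear`); the content is the convergence of ITS functions at heavy tuples.  Mechanism: with
the heavy body's `(z_b, shift_b, T)` at `m`, the calibrated field is EXACTLY `Φ_cal^s = λ_k(s)(Φ_b^s − ⟨Φ_b^s⟩)`,
`λ_k(s) = z_cal(s,k)/z_b(s,k)` (one-point subtraction + species multilinearity), so every calibrated `n`-point
function is `∏ᵢ λ_k(σᵢ)` times a fixed polynomial in heavy-body functions (convergent); biting gives
`λ_k(s)² ⟨Φ_b^s(Θf₀)Φ_b^s(f₀)⟩_conn = 1`, whose second factor tends to `c_T(s) := 𝔖₂^T(Θf₀ ⊗ f₀)`; rotation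
inheritance then follows from `T.invariant` (E1 is a FIELD of the heavy OS data).  KNOWN SEAMS (waves 1–2,
unchanged): (i) `c_T(s) > 0` for the flagged species (`glue`, `pseudoRe f g`, `f ≠ g`) is the named fact
`Literature.MathematicalPhysics.QuantumFieldTheory.KallenLehmannPositivity` (no `_holds`: needs the E1-ful OS
reconstruction); (ii) for the UNFLAGGED non-null species (`pseudoRe f f`, `pseudoIm f g`) the heavy body
asserts no non-triviality at all (`c_T(s) = 0` ⇒ `λ_k → ∞`); (iii) the heavy body is SIGN-FREE in `z`
(`sign λ_k(s) = sign z_b(s,k)` need not stabilise; `z_b := (−1)^k z` with the same `T` satisfies HB verbatim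
whenever the odd functions of `T` vanish) — (ii)/(iii) are re-typing requests on HB (`0 < z`, all non-null
species non-trivial), filed by lead 0 (CYCLE-1.md). -/
def HeavyCalibration : Prop :=
  ∀ Nf : ℕ, Nf = 2 ∨ Nf = 3 → ∀ reg : QCDRegularisation Nf, reg.HasMassScaling →
    (reg.scheme 0 0 0).HasAsymptoticScaling → (∀ᶠ k in Filter.atTop, (-1 : ℝ) < reg.mcrit k) →
      (∃ Mh : ℝ, 0 < Mh ∧ ∀ m : Fin Nf → ℝ, (∀ f, Mh ≤ m f) → Body reg m) →
        (∀ m : Fin Nf → ℝ, (∀ f, 0 < m f) → ∃ Δ > 0, (reg.scheme m 0 0).HasLatticeMassGap Δ) →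
          ∃ 𝒞 : CalibratedSpeciesFamily reg,
            ∃ Mh' : ℝ, 0 < Mh' ∧ ∀ m : Fin Nf → ℝ, (∀ f, Mh' ≤ m f) →
              ConvergesOnTensors 𝒞 m ∧ RotationsInheritedAt 𝒞 m

/-- **(V2) THE GAP BUYS A UNIFORM ANALYTIC COLLAR ALONG EVERY MASS RAY** (XL, load-bearing; UNCHANGED
registered statement).  Hypotheses = the crux's, verbatim, and a calibrated family whose calibration bites
compact-uniformly.  Conclusion: for every positive tuple `m`, every `L ≥ 1` and every off-diagonal tensor
tuple, an analytic collar (`HasAnalyticCollar`): `k`-UNIFORMITY of a zero-free collar (partition function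
and reference functions) of fixed width in renormalised units and of the bounds there — "no phase
transition at complex quark mass near the positive axis, θ = 0", a Lee–Yang / complete-analyticity
statement in the quark mass, uniform in the cutoff.  Why it might fail: no Lee–Yang-type theorem for any
gauge group beyond `ℤ₂` nor for a signed Wilson determinant; complex masses destroy reflection positivity;
the `k`-uniform bounds contain fermionic UV stability in ratio form (proved for no 4D gauge theory). -/
def AnalyticRayCollar : Prop :=
  ∀ Nf : ℕ, Nf = 2 ∨ Nf = 3 → ∀ reg : QCDRegularisation Nf, reg.HasMassScaling →
    (reg.scheme 0 0 0).HasAsymptoticScaling → (∀ᶠ k in Filter.atTop, (-1 : ℝ) < reg.mcrit k) →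
      (∃ Mh : ℝ, 0 < Mh ∧ ∀ m : Fin Nf → ℝ, (∀ f, Mh ≤ m f) → Body reg m) →
        (∀ m : Fin Nf → ℝ, (∀ f, 0 < m f) → ∃ Δ > 0, (reg.scheme m 0 0).HasLatticeMassGap Δ) →
          ∀ 𝒞 : CalibratedSpeciesFamily reg, BitesOnCompacts 𝒞 →
            ∀ m : Fin Nf → ℝ, (∀ f, 0 < m f) → ∀ L : ℝ, 1 ≤ L →
              ∀ n : ℕ, n ≠ 0 → ∀ (σ : Fin n → QCDField Nf)
                (f : Fin n → SchwartzMap (EuclideanSpace ℝ (Fin 4)) ℝ)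
                (F : SchwartzMap (Fin n → EuclideanSpace ℝ (Fin 4)) ℂ),
                IsTensorOf F (fun i => ofRealTest (f i)) → IsOffDiagonal F →
                  HasAnalyticCollar 𝒞 m L n σ f

/-- **(L_UV) LIGHT-MASS ULTRAVIOLET INPUTS OF THE CALIBRATED FAMILY** (XL).  Hypotheses = the crux's,
verbatim, a calibrated family whose calibration bites compact-uniformly, a positive tuple `m` AND
full-sequence convergence of the calibrated functions at `m` (in scope in §6 — Vitali — before L_UV is
called; reshape r2).  Conclusion: a glue `κ₃`-witness at `m` (a `k`-uniform LOWER bound of one canonical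
connected three-point function) and R′'s (T ∧ COMP) at `m` — the `k`-uniform E0′ bound of the canonical
lattice distributions on `⁰𝒮` plus the thermal comparison.  (T ∧ COMP) is, VERBATIM after instantiating
`sch := 𝒞.scheme m`, the conjunction of the two registered OPEN stubs `stub_tightness` / `stub_thermalComparison`
of item stmt-QuantumFields-11525 (`tightComp_of_pool`, §1b, kernel-checked); the `κ₃` clause's nearest pool
statement is `Kappa3` of stmt-18044's `stub_calibratedControl`.  Content: fermionic UV stability in ratio
form at light masses (the analogue of the uniform bound (17.9.1) of Glimm–Jaffe), proved for no 4D gauge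
theory; no hypothesis reaches light `m` except the lattice gap.  HAZARD (refuter verdict on stmt-14654 gen 3,
kit j013894; card device `PolyVolume` of stmt-18044): a GLOBAL E0′ bound on `⁰𝒮` is expected to fail along
regularisations whose physical volume `a_k L_k` grows sub-polynomially in `a_k⁻¹` (periodic seam of the
box-truncated smearing); the crux's heavy body (convergence for ALL Schwartz tensors) all but excludes such
`reg` — planner: add `∃ θ > 0, ∀ᶠ k, a_k^{-θ} ≤ a_k L_k` to the crux hypotheses to make this moot. -/
def LightUVInputs : Prop :=
  ∀ Nf : ℕ, Nf = 2 ∨ Nf = 3 → ∀ reg : QCDRegularisation Nf, reg.HasMassScaling →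
    (reg.scheme 0 0 0).HasAsymptoticScaling → (∀ᶠ k in Filter.atTop, (-1 : ℝ) < reg.mcrit k) →
      (∃ Mh : ℝ, 0 < Mh ∧ ∀ m : Fin Nf → ℝ, (∀ f, Mh ≤ m f) → Body reg m) →
        (∀ m : Fin Nf → ℝ, (∀ f, 0 < m f) → ∃ Δ > 0, (reg.scheme m 0 0).HasLatticeMassGap Δ) →
          ∀ 𝒞 : CalibratedSpeciesFamily reg, BitesOnCompacts 𝒞 →
            ∀ m : Fin Nf → ℝ, (∀ f, 0 < m f) → ConvergesOnTensors 𝒞 m →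
              GlueKappa3Witness 𝒞 m ∧ TightComp 𝒞 m

/-- **(L_IR) LIGHT-MASS CLUSTERING INPUTS OF THE CALIBRATED FAMILY** (L).  Hypotheses as for L_UV plus
(T ∧ COMP) at `m` (in scope in §6 before L_IR is called; reshape r2).  Conclusion: R′'s (CL) `k`-uniform
spatial clustering of the canonical lattice distributions and (CS) species Cauchy–Schwarz clustering at some
rate `Δ' > 0` at `m` — VERBATIM, after instantiating `sch := 𝒞.scheme m`, the two registered OPEN stubs
`stub_spatialClustering` / `stub_speciesCSClustering` of item stmt-QuantumFields-11525 (`lightClustering_of_pool`,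
§1b, kernel-checked).  Content: the infrared half of R′'s inputs (the Yang–Mills `GapToContinuum` defects
D2/D3: `HasLatticeMassGap` bounds FIXED pairs of local observables with per-pair constants and thresholds,
in the time direction only, while smeared species truncated functions are normalised sums over `k`-growing
families of translated pairs; given convergence, (CS) at `m` is equivalent to a continuum gap of the light
limit, `IsQCDAlong.hasSpeciesCSClustering_iff_hasMassGap`). -/
def LightClustering : Prop :=
  ∀ Nf : ℕ, Nf = 2 ∨ Nf = 3 → ∀ reg : QCDRegularisation Nf, reg.HasMassScaling →
    (reg.scheme 0 0 0).HasAsymptoticScaling → (∀ᶠ k in Filter.atTop, (-1 : ℝ) < reg.mcrit k) →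
      (∃ Mh : ℝ, 0 < Mh ∧ ∀ m : Fin Nf → ℝ, (∀ f, Mh ≤ m f) → Body reg m) →
        (∀ m : Fin Nf → ℝ, (∀ f, 0 < m f) → ∃ Δ > 0, (reg.scheme m 0 0).HasLatticeMassGap Δ) →
          ∀ 𝒞 : CalibratedSpeciesFamily reg, BitesOnCompacts 𝒞 →
            ∀ m : Fin Nf → ℝ, (∀ f, 0 < m f) → ConvergesOnTensors 𝒞 m → TightComp 𝒞 m →
              SpatialClustering 𝒞 m ∧ SpeciesClustering 𝒞 m

/-! ## §1b The pool statements the light stubs reduce to (VERBATIM registered stubs of stmt-QuantumFields-11525)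
and the kernel-checked reductions -/

/-- Statement of `Summit.QuantumFields.QCD.Cruxes.ConvergentOSClosure.Birth.stub_tightness` (T; item
stmt-QuantumFields-11525, registered, OPEN), verbatim. -/
def PoolTightness : Prop :=
  ∀ (Nf : ℕ) (reg : QCDRegularisation Nf) (𝒞 : CalibratedSpeciesFamily reg) (m : Fin Nf → ℝ),
    (∀ f, 0 < m f) → (𝒞.scheme m).HasAsymptoticScaling →
    (∀ fl : Fin Nf, ∀ᶠ k in Filter.atTop, -1 < (𝒞.scheme m).mq fl k) →
    (∃ Δ > 0, (𝒞.scheme m).HasLatticeMassGap Δ) →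
    (∀ᶠ k in Filter.atTop,
      (𝒞.scheme m).twoPoint k QCDField.glue QCDField.glue (thetaTest 4 𝒞.f₀) 𝒞.f₀ = 1) →
    (∀ f g : Fin Nf, f ≠ g → ∀ᶠ k in Filter.atTop,
      (𝒞.scheme m).twoPoint k (QCDField.pseudoRe f g) (QCDField.pseudoRe f g)
        (thetaTest 4 𝒞.f₀) 𝒞.f₀ = 1) →
    (∀ n : ℕ, n ≠ 0 → ∀ (σ : Fin n → QCDField Nf)
      (f : Fin n → SchwartzMap (EuclideanSpace ℝ (Fin 4)) ℝ) (F : SchwartzMap (Fin n → EuclideanSpace ℝ (Fin 4)) ℂ),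
      IsTensorOf F (fun i => ofRealTest (f i)) → IsOffDiagonal F →
        ∃ c : ℂ, Filter.Tendsto (fun k : ℕ => qcdLatticeSchwinger (𝒞.scheme m) k n σ f)
          Filter.atTop (nhds c)) →
    ∃ (s : ℕ) (α β : ℝ), 0 ≤ α ∧
      (∀ (n : ℕ) (σ : Fin n → QCDField Nf), ∀ᶠ k in Filter.atTop,
        ∀ F : SchwartzMap (Fin n → EuclideanSpace ℝ (Fin 4)) ℂ, IsOffDiagonal F →
          ‖qcdLatticeDist (𝒞.scheme m) k n σ F‖ ≤ α * (n.factorial : ℝ) ^ β * schwartzNorm (n * s) F)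

/-- Statement of `Summit.QuantumFields.QCD.Cruxes.ConvergentOSClosure.Birth.stub_thermalComparison` (COMP;
item stmt-QuantumFields-11525, registered, OPEN), verbatim. -/
def PoolThermalComparison : Prop :=
  ∀ (Nf : ℕ) (sch : QCDScheme Nf), Nf ≤ 16 → sch.HasAsymptoticScaling →
    (∀ fl : Fin Nf, ∀ᶠ k in Filter.atTop, -1 < sch.mq fl k) →
    (∃ Δ > 0, sch.HasLatticeMassGap Δ) →
    (∀ n : ℕ, n ≠ 0 → ∀ (σ : Fin n → QCDField Nf)
      (f : Fin n → SchwartzMap (EuclideanSpace ℝ (Fin 4)) ℝ) (F : SchwartzMap (Fin n → EuclideanSpace ℝ (Fin 4)) ℂ),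
      IsTensorOf F (fun i => ofRealTest (f i)) → IsOffDiagonal F →
        ∃ c : ℂ, Filter.Tendsto (fun k : ℕ => qcdLatticeSchwinger sch k n σ f)
          Filter.atTop (nhds c)) →
    ∀ (s : ℕ) (α β : ℝ), 0 ≤ α →
      (∀ (n : ℕ) (σ : Fin n → QCDField Nf), ∀ᶠ k in Filter.atTop,
        ∀ F : SchwartzMap (Fin n → EuclideanSpace ℝ (Fin 4)) ℂ, IsOffDiagonal F →
          ‖qcdLatticeDist sch k n σ F‖ ≤ α * (n.factorial : ℝ) ^ β * schwartzNorm (n * s) F) →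
    (∀ ε : ℝ, 0 < ε → ∀ (n : ℕ) (σ : Fin n → QCDField Nf), ∀ᶠ k in Filter.atTop,
      ∀ F : SchwartzMap (Fin n → EuclideanSpace ℝ (Fin 4)) ℂ, IsOffDiagonal F →
        ‖qcdLatticeDistSymAP sch k n σ F - qcdLatticeDist sch k n σ F‖ ≤ ε * schwartzNorm (n * s) F)

/-- Statement of `Summit.QuantumFields.QCD.Cruxes.ConvergentOSClosure.Birth.stub_spatialClustering` (CL; item
stmt-QuantumFields-11525, registered, OPEN), verbatim. -/
def PoolSpatialClustering : Prop :=
    ∀ (Nf : ℕ) (sch : QCDScheme Nf), sch.HasAsymptoticScaling →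
    (∀ fl : Fin Nf, ∀ᶠ k in Filter.atTop, -1 < sch.mq fl k) →
    (∃ Δ > 0, sch.HasLatticeMassGap Δ) →
    (∀ n : ℕ, n ≠ 0 → ∀ (σ : Fin n → QCDField Nf)
      (f : Fin n → SchwartzMap (EuclideanSpace ℝ (Fin 4)) ℝ) (F : SchwartzMap (Fin n → EuclideanSpace ℝ (Fin 4)) ℂ),
      IsTensorOf F (fun i => ofRealTest (f i)) → IsOffDiagonal F →
        ∃ c : ℂ, Filter.Tendsto (fun k : ℕ => qcdLatticeSchwinger sch k n σ f)
          Filter.atTop (nhds c)) →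
    ∀ (s : ℕ) (α β : ℝ), 0 ≤ α →
      (∀ (n : ℕ) (σ : Fin n → QCDField Nf), ∀ᶠ k in Filter.atTop,
        ∀ F : SchwartzMap (Fin n → EuclideanSpace ℝ (Fin 4)) ℂ, IsOffDiagonal F →
          ‖qcdLatticeDist sch k n σ F‖ ≤ α * (n.factorial : ℝ) ^ β * schwartzNorm (n * s) F) →
    (∀ (n n' : ℕ) (σ : Fin n → QCDField Nf) (σ' : Fin n' → QCDField Nf)
      (F : SchwartzMap (Fin n → EuclideanSpace ℝ (Fin 4)) ℂ) (G : SchwartzMap (Fin n' → EuclideanSpace ℝ (Fin 4)) ℂ),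
      IsTimeOrdered F → IsTimeOrdered G → ∀ a : EuclideanSpace ℝ (Fin 4), a 0 = 0 → a ≠ 0 →
      ∀ ε : ℝ, 0 < ε → ∃ t₀ : ℝ, ∀ t : ℝ, t₀ ≤ t →
        ∀ H : SchwartzMap (Fin (n + n') → EuclideanSpace ℝ (Fin 4)) ℂ,
          IsAppendTensorOf H (osAdjoint F) (translateMulti (t • a) G) →
          ∀ᶠ k in Filter.atTop, ‖qcdLatticeDist sch k (n + n') (Fin.append (σ ∘ Fin.rev) σ') H -
            qcdLatticeDist sch k n (σ ∘ Fin.rev) (osAdjoint F) * qcdLatticeDist sch k n' σ' G‖ ≤ ε)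

/-- Statement of `Summit.QuantumFields.QCD.Cruxes.ConvergentOSClosure.Birth.stub_speciesCSClustering` (CS; item
stmt-QuantumFields-11525, registered, OPEN), verbatim. -/
def PoolSpeciesCSClustering : Prop :=
    ∀ (Nf : ℕ) (sch : QCDScheme Nf) (Δ : ℝ), 0 < Δ → sch.HasAsymptoticScaling →
    (∀ fl : Fin Nf, ∀ᶠ k in Filter.atTop, -1 < sch.mq fl k) → sch.HasLatticeMassGap Δ →
    (∀ n : ℕ, n ≠ 0 → ∀ (σ : Fin n → QCDField Nf)
      (f : Fin n → SchwartzMap (EuclideanSpace ℝ (Fin 4)) ℝ) (F : SchwartzMap (Fin n → EuclideanSpace ℝ (Fin 4)) ℂ),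
      IsTensorOf F (fun i => ofRealTest (f i)) → IsOffDiagonal F →
        ∃ c : ℂ, Filter.Tendsto (fun k : ℕ => qcdLatticeSchwinger sch k n σ f)
          Filter.atTop (nhds c)) →
    ∀ (s : ℕ) (α β : ℝ), 0 ≤ α →
      (∀ (n : ℕ) (σ : Fin n → QCDField Nf), ∀ᶠ k in Filter.atTop,
        ∀ F : SchwartzMap (Fin n → EuclideanSpace ℝ (Fin 4)) ℂ, IsOffDiagonal F →
          ‖qcdLatticeDist sch k n σ F‖ ≤ α * (n.factorial : ℝ) ^ β * schwartzNorm (n * s) F) →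
    ∃ Δ' > 0, sch.HasSpeciesCSClustering Δ'

/-! ## §2 The registered stubs (the ONLY `sorry`s of this file) -/

/-- (V1ℓ) the calibration bites on compacts of positive tuples, for every calibrated family — L–XL. -/
theorem stub_lightBiting : LightBiting := by
  sorry

/-- (V1h′) one calibrated family: heavy convergence, heavy rotation inheritance — L. -/
theorem stub_heavyCalibration : HeavyCalibration := by
  sorry

/-- (V2) the gap buys a `k`-uniform analytic collar along every mass ray — XL, load-bearing. -/
theorem stub_analyticRayCollar : AnalyticRayCollar := by
  sorry

/-- (L_UV) light-mass UV inputs: glue `κ₃`-witness and R′'s (T ∧ COMP) at every positive tuple — XL. -/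
theorem stub_lightUVInputs : LightUVInputs := by
  sorry

/-- (L_IR) light-mass clustering inputs: R′'s (CL) and (CS) at every positive tuple — L. -/
theorem stub_lightClustering : LightClustering := by
  sorry

/-! ## §2b Name-keyed aliases of the new statements (device of `Lines/birth.lean`) -/
namespace __Registered

/-- Alias of `LightBiting` keyed by the registered stub name. -/
abbrev stub_lightBiting : Prop := LightBiting

/-- Alias of `HeavyCalibration` keyed by the registered stub name. -/
abbrev stub_heavyCalibration : Prop := HeavyCalibration

/-- Alias of `AnalyticRayCollar` keyed by the registered stub name. -/
abbrev stub_analyticRayCollar : Prop := AnalyticRayCollar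

/-- Alias of `LightUVInputs` keyed by the registered stub name. -/
abbrev stub_lightUVInputs : Prop := LightUVInputs

/-- Alias of `LightClustering` keyed by the registered stub name. -/
abbrev stub_lightClustering : Prop := LightClustering

end __Registered

/-! ## §3 Transport lemmas (sorry-free) -/

/-- The physical-branch clause is inherited from the critical mass: `m_f(k) = m_crit(k) + a_k m_f/Z_m(k)`
with `a_k, Z_m(k) > 0`. -/
theorem eventually_neg_one_lt_mq (reg : QCDRegularisation Nf) {m : Fin Nf → ℝ} (hm : ∀ f, 0 < m f)
    (hbr : ∀ᶠ k in Filter.atTop, (-1 : ℝ) < reg.mcrit k) (z shift : QCDField Nf → ℕ → ℝ) (fl : Fin Nf) :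
    ∀ᶠ k in Filter.atTop, -1 < (reg.scheme m z shift).mq fl k := by
  filter_upwards [hbr] with k hk
  have hpos : 0 < reg.a k * m fl / reg.Zm k :=
    div_pos (mul_pos (reg.a_pos k) (hm fl)) (reg.Zm_pos k)
  rw [QCDRegularisation.scheme_mq]
  linarith

/-- The uniform lattice gap never reads the species renormalisations. -/
theorem hasLatticeMassGap_scheme_iff (reg : QCDRegularisation Nf) (m : Fin Nf → ℝ)
    (z shift z' shift' : QCDField Nf → ℕ → ℝ) (Δ : ℝ) :
    (reg.scheme m z shift).HasLatticeMassGap Δ ↔ (reg.scheme m z' shift').HasLatticeMassGap Δ :=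
  Iff.rfl

/-- Asymptotic scaling never reads the masses or the species renormalisations. -/
theorem hasAsymptoticScaling_scheme_iff (reg : QCDRegularisation Nf) (m m' : Fin Nf → ℝ)
    (z shift z' shift' : QCDField Nf → ℕ → ℝ) :
    (reg.scheme m z shift).HasAsymptoticScaling ↔ (reg.scheme m' z' shift').HasAsymptoticScaling :=
  Iff.rfl

/-- The three lattice-side side conditions of R′ for the calibrated scheme `𝒞.scheme m`, assembled from
the crux's hypotheses on `reg`. -/
theorem sideConditions {reg : QCDRegularisation Nf} (𝒞 : CalibratedSpeciesFamily reg) {m : Fin Nf → ℝ}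
    (hm : ∀ f, 0 < m f) (haf : (reg.scheme 0 0 0).HasAsymptoticScaling)
    (hbr : ∀ᶠ k in Filter.atTop, (-1 : ℝ) < reg.mcrit k)
    (hgap : ∃ Δ > 0, (reg.scheme m 0 0).HasLatticeMassGap Δ) :
    (𝒞.scheme m).HasAsymptoticScaling ∧ (∀ fl : Fin Nf, ∀ᶠ k in Filter.atTop, -1 < (𝒞.scheme m).mq fl k) ∧
      ∃ Δ > 0, (𝒞.scheme m).HasLatticeMassGap Δ := by
  refine ⟨(hasAsymptoticScaling_scheme_iff reg 0 m 0 0 (𝒞.z m) (𝒞.shift m)).1 haf,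
    fun fl => eventually_neg_one_lt_mq reg hm hbr (𝒞.z m) (𝒞.shift m) fl, ?_⟩
  obtain ⟨Δ, hΔ, h⟩ := hgap
  exact ⟨Δ, hΔ, (hasLatticeMassGap_scheme_iff reg m 0 0 (𝒞.z m) (𝒞.shift m) Δ).1 h⟩

/-- `glue` is not a null field. -/
theorem glue_ne_pseudoIm (fl : Fin Nf) : (QCDField.glue : QCDField Nf) ≠ QCDField.pseudoIm fl fl := by
  intro h; cases h

/-- `pseudoRe f g` is not a null field. -/
theorem pseudoRe_ne_pseudoIm (f g fl : Fin Nf) :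
    (QCDField.pseudoRe f g : QCDField Nf) ≠ QCDField.pseudoIm fl fl := by
  intro h; cases h

/-- Compact-uniform biting gives the two calibration clauses of R′ at every positive tuple (compact set
`{m}`). -/
theorem bites_at {reg : QCDRegularisation Nf} (𝒞 : CalibratedSpeciesFamily reg) (hb : BitesOnCompacts 𝒞)
    {m : Fin Nf → ℝ} (hm : ∀ f, 0 < m f) :
    (∀ᶠ k in Filter.atTop, (𝒞.scheme m).twoPoint k QCDField.glue QCDField.glue (thetaTest 4 𝒞.f₀) 𝒞.f₀ = 1) ∧
    (∀ f g : Fin Nf, f ≠ g → ∀ᶠ k in Filter.atTop,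
      (𝒞.scheme m).twoPoint k (QCDField.pseudoRe f g) (QCDField.pseudoRe f g) (thetaTest 4 𝒞.f₀) 𝒞.f₀ = 1) := by
  have h := hb {m} isCompact_singleton (by intro m' hm'; rw [Set.mem_singleton_iff.mp hm']; exact hm)
  refine ⟨?_, fun f g _ => ?_⟩
  · filter_upwards [h] with k hk
    exact hk m (Set.mem_singleton m) QCDField.glue glue_ne_pseudoIm
  · filter_upwards [h] with k hk
    exact hk m (Set.mem_singleton m) (QCDField.pseudoRe f g) (pseudoRe_ne_pseudoIm f g)

/-- `N_f ∈ {2, 3}` is below the asymptotic-freedom bound `16` (R′'s flavour hypothesis). -/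
theorem le_sixteen_of_two_or_three {Nf : ℕ} (hNf : Nf = 2 ∨ Nf = 3) : Nf ≤ 16 := by
  rcases hNf with rfl | rfl <;> norm_num

/-! ## §3b Reductions of the light stubs to the pool stubs of stmt-QuantumFields-11525 (sorry-free) -/

/-- **(T ∧ COMP) at the light tuple from the pool stubs T and COMP of stmt-11525.**  Instantiate
`stub_tightness` at `(reg, 𝒞, m)` (its calibration clauses from `bites_at`, its side conditions from
`sideConditions`, its convergence hypothesis = ours) and `stub_thermalComparison` at `sch := 𝒞.scheme m`
(`N_f ≤ 16`) with the norm index and constants T produced. -/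
theorem tightComp_of_pool (hT : PoolTightness) (hCOMP : PoolThermalComparison) :
    ∀ Nf : ℕ, Nf = 2 ∨ Nf = 3 → ∀ reg : QCDRegularisation Nf,
      (reg.scheme 0 0 0).HasAsymptoticScaling → (∀ᶠ k in Filter.atTop, (-1 : ℝ) < reg.mcrit k) →
        (∀ m : Fin Nf → ℝ, (∀ f, 0 < m f) → ∃ Δ > 0, (reg.scheme m 0 0).HasLatticeMassGap Δ) →
          ∀ 𝒞 : CalibratedSpeciesFamily reg, BitesOnCompacts 𝒞 →
            ∀ m : Fin Nf → ℝ, (∀ f, 0 < m f) → ConvergesOnTensors 𝒞 m → TightComp 𝒞 m := by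
  intro Nf hNf reg haf hbr hgap 𝒞 hbite m hm hconv
  obtain ⟨h2g, h2q⟩ := bites_at 𝒞 hbite hm
  obtain ⟨hAS', hbr', hgap'⟩ := sideConditions 𝒞 hm haf hbr (hgap m hm)
  obtain ⟨s, α, β, hα, hb⟩ := hT Nf reg 𝒞 m hm hAS' hbr' hgap' h2g h2q hconv
  exact ⟨s, α, β, hα, hb,
    hCOMP Nf (𝒞.scheme m) (le_sixteen_of_two_or_three hNf) hAS' hbr' hgap' hconv s α β hα hb⟩

/-- **L_UV from a `κ₃`-law and the pool stubs T, COMP** (shape record: the registered light UV stub is the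
`κ₃` clause plus exactly stmt-11525's `stub_tightness ∧ stub_thermalComparison` at `sch := 𝒞.scheme m`). -/
theorem lightUVInputs_of_pool
    (hκ : ∀ Nf : ℕ, Nf = 2 ∨ Nf = 3 → ∀ reg : QCDRegularisation Nf, reg.HasMassScaling →
      (reg.scheme 0 0 0).HasAsymptoticScaling → (∀ᶠ k in Filter.atTop, (-1 : ℝ) < reg.mcrit k) →
        (∃ Mh : ℝ, 0 < Mh ∧ ∀ m : Fin Nf → ℝ, (∀ f, Mh ≤ m f) → Body reg m) →
          (∀ m : Fin Nf → ℝ, (∀ f, 0 < m f) → ∃ Δ > 0, (reg.scheme m 0 0).HasLatticeMassGap Δ) →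
            ∀ 𝒞 : CalibratedSpeciesFamily reg, BitesOnCompacts 𝒞 →
              ∀ m : Fin Nf → ℝ, (∀ f, 0 < m f) → ConvergesOnTensors 𝒞 m → GlueKappa3Witness 𝒞 m)
    (hT : PoolTightness) (hCOMP : PoolThermalComparison) : LightUVInputs :=
  fun Nf hNf reg hms haf hbr hbody hgap 𝒞 hbite m hm hconv =>
    ⟨hκ Nf hNf reg hms haf hbr hbody hgap 𝒞 hbite m hm hconv,
      tightComp_of_pool hT hCOMP Nf hNf reg haf hbr hgap 𝒞 hbite m hm hconv⟩

/-- **L_IR from the pool stubs CL and CS of stmt-11525** (the registered light clustering stub IS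
`stub_spatialClustering ∧ stub_speciesCSClustering` at `sch := 𝒞.scheme m`; adapted from the wave-2 worker's
kernel-checked `lightClustering'_of`). -/
theorem lightClustering_of_pool (hCL : PoolSpatialClustering) (hCS : PoolSpeciesCSClustering) :
    LightClustering := by
  intro Nf _hNf reg _hms haf hbr _hbody hgap 𝒞 _hbite m hm hconv hTC
  obtain ⟨hAS', hbr', -⟩ := sideConditions 𝒞 hm haf hbr (hgap m hm)
  obtain ⟨Δ, hΔ, hgapΔ⟩ := hgap m hm
  have hgap' : (𝒞.scheme m).HasLatticeMassGap Δ :=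
    (hasLatticeMassGap_scheme_iff reg m 0 0 (𝒞.z m) (𝒞.shift m) Δ).1 hgapΔ
  obtain ⟨s, α, β, hα, hb, -⟩ := hTC
  exact ⟨fun n n' σ σ' F G hF hG a ha0 ha ε hε =>
      hCL Nf (𝒞.scheme m) hAS' hbr' ⟨Δ, hΔ, hgap'⟩ hconv s α β hα hb n n' σ σ' F G hF hG a ha0 ha ε hε,
    hCS Nf (𝒞.scheme m) Δ hΔ hAS' hbr' hgap' hconv s α β hα hb⟩

/-! ## §4 Vitali descent (sorry-free): heavy convergence + analytic collar ⇒ convergence at `m` -/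

/-- **Heavy points of the ray.**  With `L := 2 + ∑_f M/m_f`, every `l ∈ [L−1, L]` makes `l • m` heavy:
`M ≤ l * m f` for every flavour. -/
theorem heavy_of_mem_Icc {m : Fin Nf → ℝ} (hm : ∀ f, 0 < m f) {M : ℝ} (hM : 0 < M) {l : ℝ}
    (hl : l ∈ Set.Icc (2 + ∑ g, M / m g - 1) (2 + ∑ g, M / m g)) (f : Fin Nf) : M ≤ l * m f := by
  have hterm : ∀ g, 0 ≤ M / m g := fun g => div_nonneg hM.le (hm g).le
  have h1 : M / m f ≤ ∑ g, M / m g := Finset.single_le_sum (fun g _ => hterm g) (Finset.mem_univ f)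
  have h2 : M / m f ≤ l := by have := hl.1; linarith
  calc M = M / m f * m f := by rw [div_mul_cancel₀ _ (hm f).ne']
    _ ≤ l * m f := mul_le_mul_of_nonneg_right h2 (hm f).le

/-- The heavy segment `[L−1, L]`, read in `ℂ`, accumulates at its left end point `L − 1` (in-tree
`Literature.Analysis.Complex.frequently_nhdsNE_ofReal_mem_image_Icc`). -/
theorem heavySegment_accumulates (L : ℝ) :
    ∃ᶠ z in 𝓝[≠] (((L - 1 : ℝ)) : ℂ), z ∈ (fun t : ℝ => (t : ℂ)) '' Set.Icc (L - 1) L :=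
  Literature.Analysis.Complex.frequently_nhdsNE_ofReal_mem_image_Icc ⟨le_rfl, by linarith⟩

/-- **VITALI, PACKAGED.**  On a connected open `U` containing the real segment `[1, L]` (`2 ≤ L`), a
sequence `G_k` of holomorphic functions bounded by one constant which converges at every real point of
`[L−1, L]` converges locally uniformly on `U` to a holomorphic limit (the heavy segment accumulates at
`L − 1 ∈ U`; in-tree accumulating-set Vitali `exists_tendstoLocallyUniformlyOn_of_tendsto_on`). -/
theorem exists_limit_of_collar {U : Set ℂ} (hUo : IsOpen U) (hUc : IsPreconnected U) {L : ℝ} (hL2 : 2 ≤ L)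
    (hseg : ∀ l : ℝ, l ∈ Set.Icc 1 L → ((l : ℂ) ∈ U)) {C : ℝ} {G : ℕ → ℂ → ℂ}
    (hGd : ∀ k, DifferentiableOn ℂ (G k) U) (hGb : ∀ k, ∀ w ∈ U, ‖G k w‖ ≤ C)
    (hconv : ∀ l : ℝ, l ∈ Set.Icc (L - 1) L →
      ∃ c : ℂ, Filter.Tendsto (fun k : ℕ => G k (l : ℂ)) Filter.atTop (nhds c)) :
    ∃ Glim : ℂ → ℂ, DifferentiableOn ℂ Glim U ∧ TendstoLocallyUniformlyOn G Glim Filter.atTop U := by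
  have hz₀U : (((L - 1 : ℝ)) : ℂ) ∈ U := hseg (L - 1) ⟨by linarith, by linarith⟩
  have hb : ∀ a ∈ U, ∃ M' : ℝ, ∃ r > 0, ∀ k, ∀ z ∈ Metric.ball a r ∩ U, ‖G k z‖ ≤ M' :=
    fun a _ => ⟨C, 1, one_pos, fun k z hz => hGb k z hz.2⟩
  refine Literature.Analysis.Complex.exists_tendstoLocallyUniformlyOn_of_tendsto_on hUo hUc hGd hb hz₀U
    (heavySegment_accumulates L) ?_
  rintro _ ⟨l, hl, rfl⟩
  exact hconv l hl

/-- **VITALI DESCENT.**  If the calibrated family converges at every heavy tuple (above `M`) and the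
calibrated `n`-point functions of `(σ, f)` along the ray segment `[1, L]·m`, `L := 2 + ∑_f M/m_f`, have an
analytic collar, then they converge at `m` along the FULL sequence. -/
theorem tendsto_of_collar {reg : QCDRegularisation Nf} (𝒞 : CalibratedSpeciesFamily reg) {m : Fin Nf → ℝ}
    (hm : ∀ f, 0 < m f) {M : ℝ} (hM : 0 < M)
    (hheavy : ∀ m' : Fin Nf → ℝ, (∀ f, M ≤ m' f) → ConvergesOnTensors 𝒞 m')
    {n : ℕ} (hn : n ≠ 0) (σ : Fin n → QCDField Nf) (f : Fin n → SchwartzMap (EuclideanSpace ℝ (Fin 4)) ℝ)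
    (F : SchwartzMap (Fin n → EuclideanSpace ℝ (Fin 4)) ℂ)
    (hT : IsTensorOf F (fun i => ofRealTest (f i))) (hO : IsOffDiagonal F)
    (hcollar : HasAnalyticCollar 𝒞 m (2 + ∑ g, M / m g) n σ f) :
    ∃ c : ℂ, Filter.Tendsto (fun k : ℕ => qcdLatticeSchwinger (𝒞.scheme m) k n σ f) Filter.atTop (nhds c) := by
  set L : ℝ := 2 + ∑ g, M / m g with hLdef
  have hterm : ∀ g, 0 ≤ M / m g := fun g => div_nonneg hM.le (hm g).le
  have hsum : 0 ≤ ∑ g, M / m g := Finset.sum_nonneg fun g _ => hterm g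
  have hL2 : 2 ≤ L := by rw [hLdef]; linarith
  obtain ⟨U, hUo, hUc, hseg, C, G, hGd, hGb, hGeq⟩ := hcollar
  -- convergence of `G k` at every real point of `[L - 1, L]`
  have hconv : ∀ l : ℝ, l ∈ Set.Icc (L - 1) L →
      ∃ c : ℂ, Filter.Tendsto (fun k : ℕ => G k (l : ℂ)) Filter.atTop (nhds c) := by
    intro l hl
    have hlm : ∀ fl, M ≤ (l • m) fl := fun fl => by
      simpa [Pi.smul_apply, smul_eq_mul] using heavy_of_mem_Icc hm hM hl fl
    obtain ⟨c, hc⟩ := hheavy (l • m) hlm n hn σ f F hT hO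
    have hl1 : l ∈ Set.Icc 1 L := ⟨by have := hl.1; linarith, hl.2⟩
    refine ⟨c, hc.congr' ?_⟩
    filter_upwards [hGeq] with k hk
    exact (hk l hl1).symm
  obtain ⟨Glim, -, hlim⟩ := exists_limit_of_collar hUo hUc hL2 hseg hGd hGb hconv
  have h1U : ((1 : ℝ) : ℂ) ∈ U := hseg 1 ⟨le_rfl, by linarith⟩
  have h1 : Filter.Tendsto (fun k => G k ((1 : ℝ) : ℂ)) Filter.atTop (nhds (Glim ((1 : ℝ) : ℂ))) :=
    hlim.tendsto_at h1U
  refine ⟨Glim ((1 : ℝ) : ℂ), h1.congr' ?_⟩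
  filter_upwards [hGeq] with k hk
  rw [hk 1 ⟨le_rfl, by linarith⟩, one_smul]

/-- **Light convergence from heavy convergence and the collars.** -/
theorem convergesOnTensors_of_collars {reg : QCDRegularisation Nf} (𝒞 : CalibratedSpeciesFamily reg)
    {m : Fin Nf → ℝ} (hm : ∀ f, 0 < m f) {M : ℝ} (hM : 0 < M)
    (hheavy : ∀ m' : Fin Nf → ℝ, (∀ f, M ≤ m' f) → ConvergesOnTensors 𝒞 m')
    (hcollar : ∀ L : ℝ, 1 ≤ L → ∀ n : ℕ, n ≠ 0 → ∀ (σ : Fin n → QCDField Nf)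
      (f : Fin n → SchwartzMap (EuclideanSpace ℝ (Fin 4)) ℝ)
      (F : SchwartzMap (Fin n → EuclideanSpace ℝ (Fin 4)) ℂ),
      IsTensorOf F (fun i => ofRealTest (f i)) → IsOffDiagonal F → HasAnalyticCollar 𝒞 m L n σ f) :
    ConvergesOnTensors 𝒞 m := by
  intro n hn σ f F hT hO
  have hterm : ∀ g, 0 ≤ M / m g := fun g => div_nonneg hM.le (hm g).le
  have hsum : 0 ≤ ∑ g, M / m g := Finset.sum_nonneg fun g _ => hterm g
  have hL1 : (1 : ℝ) ≤ 2 + ∑ g, M / m g := by linarith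
  exact tendsto_of_collar 𝒞 hm hM hheavy hn σ f F hT hO (hcollar _ hL1 n hn σ f F hT hO)

/-! ## §4b Rotations ride the collar (sorry-free): E1 of the heavy body descends by the identity theorem -/

/-- **A common connected collar for two tuples.**  Two analytic collars along the same segment `[1, L]`
(`1 ≤ L`) restrict to a PAIRED collar on one connected open set: the connected component of `1` in the
intersection of the two open sets (open by local connectedness of `ℂ`, containing the connected segment). -/
theorem hasPairedCollar_of_collars {reg : QCDRegularisation Nf} (𝒞 : CalibratedSpeciesFamily reg)
    {m : Fin Nf → ℝ} {L : ℝ} (hL : 1 ≤ L) {n : ℕ} {σ : Fin n → QCDField Nf}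
    {f f' : Fin n → SchwartzMap (EuclideanSpace ℝ (Fin 4)) ℝ}
    (h : HasAnalyticCollar 𝒞 m L n σ f) (h' : HasAnalyticCollar 𝒞 m L n σ f') :
    HasPairedCollar 𝒞 m L n σ f f' := by
  obtain ⟨U, hUo, -, hseg, C, G, hGd, hGb, hGeq⟩ := h
  obtain ⟨U', hU'o, -, hseg', C', G', hG'd, hG'b, hG'eq⟩ := h'
  -- one connected open `V` between the segment and `U ∩ U'` (in-tree `exists_open_preconnected_between`)
  obtain ⟨V, hVo, hVc, hSV, hVW⟩ :=
    Literature.Analysis.Complex.exists_open_preconnected_between hUo hU'o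
      (Literature.Analysis.Complex.isPreconnected_ofReal_image_Icc 1 L) (x := ((1 : ℝ) : ℂ))
      ⟨1, ⟨le_rfl, hL⟩, rfl⟩ (by rintro _ ⟨t, ht, rfl⟩; exact hseg t ht) (by rintro _ ⟨t, ht, rfl⟩; exact hseg' t ht)
  have hsegV : ∀ l : ℝ, l ∈ Set.Icc 1 L → ((l : ℂ) ∈ V) := fun l hl => hSV ⟨l, hl, rfl⟩
  refine ⟨V, hVo, hVc, hsegV, max C C', G, G', fun k => (hGd k).mono fun w hw => (hVW hw).1,
    fun k => (hG'd k).mono fun w hw => (hVW hw).2,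
    fun k w hw => (hGb k w (hVW hw).1).trans (le_max_left _ _),
    fun k w hw => (hG'b k w (hVW hw).2).trans (le_max_right _ _), ?_⟩
  filter_upwards [hGeq, hG'eq] with k hk hk'
  exact fun l hl => ⟨hk l hl, hk' l hl⟩

/-- **THE IDENTITY THEOREM ON THE ROTATION DEFECT.**  On a paired collar along `[1, L]·m`,
`L := 2 + ∑_f M/m_f`, suppose both sequences converge at every heavy real point `l ∈ [L−1, L]` to the SAME
value.  Then the two Vitali limits are holomorphic on the connected `U` and agree on the heavy segment,
hence everywhere on `U` (`AnalyticOnNhd.eqOn_of_preconnected_of_frequently_eq`), in particular at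
`l = 1`: any limits `c, c'` of the two sequences at the light tuple coincide. -/
theorem limits_agree_of_pairedCollar {reg : QCDRegularisation Nf} (𝒞 : CalibratedSpeciesFamily reg)
    {m : Fin Nf → ℝ} (hm : ∀ f, 0 < m f) {M : ℝ} (hM : 0 < M)
    {n : ℕ} {σ : Fin n → QCDField Nf} {f f' : Fin n → SchwartzMap (EuclideanSpace ℝ (Fin 4)) ℝ}
    (hpair : HasPairedCollar 𝒞 m (2 + ∑ g, M / m g) n σ f f')
    (hagree : ∀ l : ℝ, l ∈ Set.Icc (2 + ∑ g, M / m g - 1) (2 + ∑ g, M / m g) →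
      ∃ c : ℂ, Filter.Tendsto (fun k : ℕ => qcdLatticeSchwinger (𝒞.scheme (l • m)) k n σ f) Filter.atTop (nhds c) ∧
        Filter.Tendsto (fun k : ℕ => qcdLatticeSchwinger (𝒞.scheme (l • m)) k n σ f') Filter.atTop (nhds c))
    {c c' : ℂ} (hc : Filter.Tendsto (fun k : ℕ => qcdLatticeSchwinger (𝒞.scheme m) k n σ f) Filter.atTop (nhds c))
    (hc' : Filter.Tendsto (fun k : ℕ => qcdLatticeSchwinger (𝒞.scheme m) k n σ f') Filter.atTop (nhds c')) :
    c' = c := by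
  set L : ℝ := 2 + ∑ g, M / m g with hLdef
  have hterm : ∀ g, 0 ≤ M / m g := fun g => div_nonneg hM.le (hm g).le
  have hsum : 0 ≤ ∑ g, M / m g := Finset.sum_nonneg fun g _ => hterm g
  have hL2 : 2 ≤ L := by rw [hLdef]; linarith
  obtain ⟨U, hUo, hUc, hseg, C, G, G', hGd, hG'd, hGb, hG'b, hGeq⟩ := hpair
  have hz₀U : (((L - 1 : ℝ)) : ℂ) ∈ U := hseg (L - 1) ⟨by linarith, by linarith⟩
  have h1U : ((1 : ℝ) : ℂ) ∈ U := hseg 1 ⟨le_rfl, by linarith⟩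
  have hbG : ∀ a ∈ U, ∃ M' : ℝ, ∃ r > 0, ∀ k, ∀ z ∈ Metric.ball a r ∩ U, ‖G k z‖ ≤ M' :=
    fun a _ => ⟨C, 1, one_pos, fun k z hz => hGb k z hz.2⟩
  have hbG' : ∀ a ∈ U, ∃ M' : ℝ, ∃ r > 0, ∀ k, ∀ z ∈ Metric.ball a r ∩ U, ‖G' k z‖ ≤ M' :=
    fun a _ => ⟨C, 1, one_pos, fun k z hz => hG'b k z hz.2⟩
  -- both sequences converge to a common value at every point of the heavy segment
  have hagree' : ∀ z ∈ (fun t : ℝ => (t : ℂ)) '' Set.Icc (L - 1) L,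
      ∃ c₀ : ℂ, Filter.Tendsto (fun k => G k z) Filter.atTop (nhds c₀) ∧
        Filter.Tendsto (fun k => G' k z) Filter.atTop (nhds c₀) := by
    rintro _ ⟨l, hl, rfl⟩
    obtain ⟨c₀, h₀, h₀'⟩ := hagree l hl
    have hl1 : l ∈ Set.Icc 1 L := ⟨by have := hl.1; linarith, hl.2⟩
    refine ⟨c₀, h₀.congr' ?_, h₀'.congr' ?_⟩
    · filter_upwards [hGeq] with k hk
      exact (hk l hl1).1.symm
    · filter_upwards [hGeq] with k hk
      exact (hk l hl1).2.symm
  -- the two sequences at `l = 1` ARE the calibrated functions at `m` eventually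
  have hcG : Filter.Tendsto (fun k => G k ((1 : ℝ) : ℂ)) Filter.atTop (nhds c) := by
    refine hc.congr' ?_
    filter_upwards [hGeq] with k hk
    rw [(hk 1 ⟨le_rfl, by linarith⟩).1, one_smul]
  have hcG' : Filter.Tendsto (fun k => G' k ((1 : ℝ) : ℂ)) Filter.atTop (nhds c') := by
    refine hc'.congr' ?_
    filter_upwards [hGeq] with k hk
    rw [(hk 1 ⟨le_rfl, by linarith⟩).2, one_smul]
  -- IDENTITY TRANSPORT (in-tree `Literature.Analysis.Complex.limit_eq_of_agree_on`)
  exact (Literature.Analysis.Complex.limit_eq_of_agree_on hUo hUc hGd hG'd hbG hbG' hz₀U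
    (heavySegment_accumulates L) (by rintro _ ⟨l, hl, rfl⟩; exact hseg l ⟨by have := hl.1; linarith, hl.2⟩)
    hagree' h1U hcG hcG').symm

/-- **ROTATIONS RIDE THE COLLAR.**  If the calibrated family converges AND inherits rotations at every heavy
tuple (above `M`), and every off-diagonal real tensor tuple has an analytic collar along the ray through the
light tuple `m`, then rotations are inherited at `m`: for a proper rotation `R`, the rotated tuple
`fᵢ ∘ R⁻¹` is again an off-diagonal real tensor tuple (`isTensorOf_linActMulti_ofRealTest`,
`isOffDiagonal_linActMulti`), the two collars pair on a common connected set, the two sequences converge to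
a common value at every heavy point (heavy convergence + heavy inheritance), and the identity theorem
(`limits_agree_of_pairedCollar`) equates the light limits. -/
theorem rotationsInheritedAt_of_collars {reg : QCDRegularisation Nf} (𝒞 : CalibratedSpeciesFamily reg)
    {m : Fin Nf → ℝ} (hm : ∀ f, 0 < m f) {M : ℝ} (hM : 0 < M)
    (hheavy : ∀ m' : Fin Nf → ℝ, (∀ f, M ≤ m' f) → ConvergesOnTensors 𝒞 m')
    (hrot : ∀ m' : Fin Nf → ℝ, (∀ f, M ≤ m' f) → RotationsInheritedAt 𝒞 m')
    (hcollar : ∀ L : ℝ, 1 ≤ L → ∀ n : ℕ, n ≠ 0 → ∀ (σ : Fin n → QCDField Nf)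
      (f : Fin n → SchwartzMap (EuclideanSpace ℝ (Fin 4)) ℝ)
      (F : SchwartzMap (Fin n → EuclideanSpace ℝ (Fin 4)) ℂ),
      IsTensorOf F (fun i => ofRealTest (f i)) → IsOffDiagonal F → HasAnalyticCollar 𝒞 m L n σ f) :
    RotationsInheritedAt 𝒞 m := by
  intro n hn σ f F hT hO R hR c c' hc hc'
  set L : ℝ := 2 + ∑ g, M / m g with hLdef
  have hterm : ∀ g, 0 ≤ M / m g := fun g => div_nonneg hM.le (hm g).le
  have hsum : 0 ≤ ∑ g, M / m g := Finset.sum_nonneg fun g _ => hterm g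
  have hL1 : (1 : ℝ) ≤ L := by rw [hLdef]; linarith
  -- the rotated tuple and its tensor
  set f' : Fin n → SchwartzMap (EuclideanSpace ℝ (Fin 4)) ℝ := fun i => linActTest (𝕜 := ℝ) R (f i) with hf'
  have hT' : IsTensorOf (linActMulti R F) (fun i => ofRealTest (f' i)) := isTensorOf_linActMulti_ofRealTest R hT
  have hO' : IsOffDiagonal (linActMulti R F) := isOffDiagonal_linActMulti R hO
  -- paired collar
  have hpair : HasPairedCollar 𝒞 m L n σ f f' :=
    hasPairedCollar_of_collars 𝒞 hL1 (hcollar L hL1 n hn σ f F hT hO)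
      (hcollar L hL1 n hn σ f' (linActMulti R F) hT' hO')
  -- common heavy values
  have hagree : ∀ l : ℝ, l ∈ Set.Icc (L - 1) L →
      ∃ c₀ : ℂ, Filter.Tendsto (fun k : ℕ => qcdLatticeSchwinger (𝒞.scheme (l • m)) k n σ f) Filter.atTop (nhds c₀) ∧
        Filter.Tendsto (fun k : ℕ => qcdLatticeSchwinger (𝒞.scheme (l • m)) k n σ f') Filter.atTop (nhds c₀) := by
    intro l hl
    have hlm : ∀ fl, M ≤ (l • m) fl := fun fl => by
      simpa [Pi.smul_apply, smul_eq_mul] using heavy_of_mem_Icc hm hM hl fl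
    obtain ⟨c₀, h₀⟩ := hheavy (l • m) hlm n hn σ f F hT hO
    obtain ⟨c₀', h₀'⟩ := hheavy (l • m) hlm n hn σ f' (linActMulti R F) hT' hO'
    have heq : c₀' = c₀ := hrot (l • m) hlm n hn σ f F hT hO R hR c₀ c₀' h₀ h₀'
    exact ⟨c₀, h₀, heq ▸ h₀'⟩
  exact limits_agree_of_pairedCollar 𝒞 hm hM hpair hagree hc hc'

/-! ## §4c Packaging (sorry-free): from inherited rotations to R′'s rotation hypothesis on `⁰𝒮` -/

/-- **R′'s rotation input from rotation inheritance.**  If the labelled family `S` IS the limit of the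
calibrated functions at `m` on off-diagonal real tensors and rotations are inherited at `m`, then
`S n σ (F ∘ R⁻¹) = S n σ F` for every proper rotation `R` and EVERY `F ∈ ⁰𝒮`: on separated real tensors
both sides are limits of lattice sequences whose limits agree (`RotationsInheritedAt`), and separated real
tensors are total in `⁰𝒮` for the pair of continuous linear functionals `S n σ ∘ linActMulti R`, `S n σ`
(`stub_separatedTensorsTotal`, landed p151153); `n = 0` is trivial (`linActMulti_fin_zero`). -/
theorem rotation_hypothesis_of_inherited {reg : QCDRegularisation Nf} (𝒞 : CalibratedSpeciesFamily reg)
    (m : Fin Nf → ℝ) (S : LabelledSchwingerFamily (QCDField Nf) (EuclideanSpace ℝ (Fin 4)))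
    (hS : ∀ n : ℕ, n ≠ 0 → ∀ (σ : Fin n → QCDField Nf) (f : Fin n → SchwartzMap (EuclideanSpace ℝ (Fin 4)) ℝ)
      (F : SchwartzMap (Fin n → EuclideanSpace ℝ (Fin 4)) ℂ), IsTensorOf F (fun i => ofRealTest (f i)) →
        IsOffDiagonal F → Filter.Tendsto (fun k : ℕ => qcdLatticeSchwinger (𝒞.scheme m) k n σ f) Filter.atTop (nhds (S n σ F)))
    (hrot : RotationsInheritedAt 𝒞 m) :
    ∀ (n : ℕ) (σ : Fin n → QCDField Nf) (Rot : EuclideanSpace ℝ (Fin 4) ≃ₗᵢ[ℝ] EuclideanSpace ℝ (Fin 4)),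
      LinearMap.det (Rot.toLinearEquiv : EuclideanSpace ℝ (Fin 4) →ₗ[ℝ] EuclideanSpace ℝ (Fin 4)) = 1 →
        ∀ F : SchwartzMap (Fin n → EuclideanSpace ℝ (Fin 4)) ℂ, IsOffDiagonal F →
          S n σ (linActMulti Rot F) = S n σ F := by
  intro n σ Rot hRot F hF
  rcases Nat.eq_zero_or_pos n with rfl | hn
  · rw [linActMulti_fin_zero]
  · have key : ∀ f : Fin n → SchwartzMap (EuclideanSpace ℝ (Fin 4)) ℝ, IsSeparated f →
        ∀ G : SchwartzMap (Fin n → EuclideanSpace ℝ (Fin 4)) ℂ, IsTensorOf G (fun i => ofRealTest (f i)) →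
          ((S n σ).comp (linActMulti Rot)) G = S n σ G := by
      intro f hf G hG
      have hoff : IsOffDiagonal G := isOffDiagonal_of_isSeparated hf hG
      have hG' : IsTensorOf (linActMulti Rot G) (fun i => ofRealTest (linActTest (𝕜 := ℝ) Rot (f i))) :=
        isTensorOf_linActMulti_ofRealTest Rot hG
      have hoff' : IsOffDiagonal (linActMulti Rot G) := isOffDiagonal_linActMulti Rot hoff
      have h₁ := hS n hn.ne' σ f G hG hoff
      have h₂ := hS n hn.ne' σ (fun i => linActTest (𝕜 := ℝ) Rot (f i)) (linActMulti Rot G) hG' hoff'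
      rw [ContinuousLinearMap.comp_apply]
      exact hrot n hn.ne' σ f G hG hoff Rot hRot _ _ h₁ h₂
    have h := stub_separatedTensorsTotal n ((S n σ).comp (linActMulti Rot)) (S n σ) key F hF
    rwa [ContinuousLinearMap.comp_apply] at h

/-! ## §6 Composition (kernel-checked): the crux BY NAME from the five stub statements -/

/-- **THE CRUX FROM THE FIVE STUB STATEMENTS** — concludes
`Summit.QuantumFields.QCD.Theses.EulerDescent.RetypedContinuumComplement` BY NAME.  Fix `N_f ∈ {2,3}`,
`reg` with the crux's hypotheses and a positive tuple `m`.  V1h′ gives the calibrated family `𝒞` with,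
above `M_h'`, heavy convergence and heavy rotation inheritance; V1ℓ gives compact biting of ITS calibration;
V2 gives the analytic collars along the ray through `m`; §4 (Vitali) turns them into full-sequence
convergence at `m` and §4b (identity theorem) into rotation inheritance at `m`; §3 supplies the
calibration clauses at `m` and transports scaling / branch / gap to `𝒞.scheme m`; L_UV gives the
`κ₃`-witness and (T ∧ COMP) at `m`, L_IR gives (CL), (CS) at `m`; the LANDED repaired OS closure R′
(`convergentOSClosure_retyped`, p161129) closes the limit family `S` with both gaps at one `Δ`; §4c feeds
its packaging clause the rotation input; `(𝒞.z m, 𝒞.shift m, T)` is the body at `m`. -/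
theorem RetypedContinuumComplement_of :
    __Registered.stub_lightBiting → __Registered.stub_heavyCalibration → __Registered.stub_analyticRayCollar →
      __Registered.stub_lightUVInputs → __Registered.stub_lightClustering → RetypedContinuumComplement := by
  intro hLight hHeavy hCollar hUV hIR Nf hNf reg hms haf hbr hbody hgap m hm
  obtain ⟨𝒞, Mh', hMh', hheavy⟩ := hHeavy Nf hNf reg hms haf hbr hbody hgap
  have hbite : BitesOnCompacts 𝒞 := hLight Nf hNf reg hms haf hbr hbody hgap 𝒞
  have hconvHeavy : ∀ m' : Fin Nf → ℝ, (∀ f, Mh' ≤ m' f) → ConvergesOnTensors 𝒞 m' :=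
    fun m' hm' => (hheavy m' hm').1
  have hrotHeavy : ∀ m' : Fin Nf → ℝ, (∀ f, Mh' ≤ m' f) → RotationsInheritedAt 𝒞 m' :=
    fun m' hm' => (hheavy m' hm').2
  have hcollars := hCollar Nf hNf reg hms haf hbr hbody hgap 𝒞 hbite m hm
  have hcollar' : ∀ L : ℝ, 1 ≤ L → ∀ n : ℕ, n ≠ 0 → ∀ (σ : Fin n → QCDField Nf)
      (f : Fin n → SchwartzMap (EuclideanSpace ℝ (Fin 4)) ℝ)
      (F : SchwartzMap (Fin n → EuclideanSpace ℝ (Fin 4)) ℂ),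
      IsTensorOf F (fun i => ofRealTest (f i)) → IsOffDiagonal F → HasAnalyticCollar 𝒞 m L n σ f :=
    fun L hL n hn σ f F hT hO => hcollars L hL n hn σ f F hT hO
  have hconv : ConvergesOnTensors 𝒞 m := convergesOnTensors_of_collars 𝒞 hm hMh' hconvHeavy hcollar'
  have hrot : RotationsInheritedAt 𝒞 m := rotationsInheritedAt_of_collars 𝒞 hm hMh' hconvHeavy hrotHeavy hcollar'
  obtain ⟨h2g, h2q⟩ := bites_at 𝒞 hbite hm
  obtain ⟨hAS', hbr', hgap'⟩ := sideConditions 𝒞 hm haf hbr (hgap m hm)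
  obtain ⟨hκ, hTC⟩ := hUV Nf hNf reg hms haf hbr hbody hgap 𝒞 hbite m hm hconv
  obtain ⟨hCL, hCS⟩ := hIR Nf hNf reg hms haf hbr hbody hgap 𝒞 hbite m hm hconv hTC
  obtain ⟨S, -, -, -, -, -, -, -, hConvS, ⟨Δ, hΔ, hGapS, hGapL⟩, hPack⟩ :=
    Summit.QuantumFields.QCD.Theorems.ConvergentOSClosure.convergentOSClosure_retyped Nf reg 𝒞 m
      (le_sixteen_of_two_or_three hNf) hm hAS' hbr' hgap' h2g h2q hκ hconv hTC hCL hCS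
  have hE1 := rotation_hypothesis_of_inherited 𝒞 m S hConvS hrot
  obtain ⟨T, hTS, hNT, hNG, hND⟩ := hPack hE1
  subst hTS
  exact ⟨𝒞.z m, 𝒞.shift m, T, ⟨hAS', hbr', hConvS⟩, hNT, hNG, hND, Δ, hΔ, hGapS, hGapL⟩

/-- The crux along this skeleton, from the registered stubs (sorries only inside the four `stub_*`). -/
theorem retypedContinuumComplement_of_stubs : RetypedContinuumComplement :=
  RetypedContinuumComplement_of stub_lightBiting stub_heavyCalibration stub_analyticRayCollar
    stub_lightUVInputs stub_lightClustering

/-- Shape record over the UNALIASED statements. -/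
example : LightBiting → HeavyCalibration → AnalyticRayCollar → LightUVInputs → LightClustering →
    Summit.QuantumFields.QCD.Theses.EulerDescent.RetypedContinuumComplement :=
  RetypedContinuumComplement_of

end Summit.QuantumFields.QCD.Cruxes.RetypedContinuumComplement.VitaliMassDescent

end
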